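import Literature.AlgebraicGeometry.Motives.KahnPartialSemisimplicityPoincareDuality
import Literature.AlgebraicGeometry.Motives.TateClassesDominationSplitting
import HarnessLib

/-!
# Kahn's `S^i(X, l)` — «`H^{2i}(X)(i)^G ↪ H^{2i}(X)(i) → H^{2i}(X)(i)_G` is bijective» — descends to
# dominated varieties (an equivariant retract of `V^G ⊕ 𝔞V = V` splits the same way)

Topic `Literature/AlgebraicGeometry/Motives`; THEOREMS ONLY (no definition, no instance, no named
fact; D-0026).

B. Kahn, *Zeta and L-functions of varieties and motives* (2020) §6.14 (held, p. 132): «`S^i(X, l)` The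
composition `H^{2i}_l(X)(i)^G ↪ H^{2i}_l(X)(i) → H^{2i}_l(X)(i)_G` is bijective.»; §3.5.1 (direct images,
the projection formula) and §6.11 Lemma 6.30 (2) (`f₊(f^*x · ζ) = q x`: a dominated variety is a direct
summand).  S. Kleiman, *Algebraic cycles and the Weil conjectures* (1968) Prop. 1.2.4 (`f^*` is
injective when `f₊ζ ≠ 0`).  J. Tate, *Conjectures on algebraic cycles in ℓ-adic cohomology* (1994) §1
(the conjectures for `U` follow from those for `V` dominating `U`).

For the tree's abstract `E : GaloisWeilCohomology k K χ` (any field `k`) and `f : V ⟶ U` between smooth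
projective varieties with a rational algebraic class `ζ ∈ Aʳ(V)_ℚ`, `dim V = dim U + r`, `f₊ζ ≠ 0`
(so `f₊ζ = q·1`, `q ∈ ℚˣ`), the transfer `T = f₊(· ∪ ζ) : Hⁱ(V) → Hⁱ(U)` is `Γ_k`-equivariant for every
twist (gen-36∕37 `ρTwist_pushforward_cup`) and `T ∘ f^* = q` (`pushforward_pullback_cup_eq_smul`).
This file proves:

* §1 (pure, ns `Literature.LinearAlgebra.InvariantPairing`) **AN EQUIVARIANT RETRACT UP TO A NON-ZERO
  SCALAR INHERITS `V = V^G ⊕ 𝔞V`** (`isCompl_invariants_coinvariantsKer_of_retract`: with equivariant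
  `e : U → V`, `T : V → U`, `T ∘ e = q ≠ 0`: `U^G ∩ 𝔞U` embeds into `V^G ∩ 𝔞V = 0`, and
  `q u = T(e u) = T i + T a ∈ U^G + 𝔞U`), after the elementary facts that equivariant maps preserve
  invariants and augmentation submodules.
* §2 **KAHN'S `S` DESCENDS ALONG DOMINATIONS**: `Hⁱ(V)(j) = H^Γ ⊕ 𝔞H ⟹ Hⁱ(U)(j) = H^Γ ⊕ 𝔞H`
  (`isCompl_invariants_coinvariantsKer_of_pushforward_ne_zero`), in Kahn's degrees and bijectivity form
  `S^p(V) ⟹ S^p(U)` (`kahnS_of_pushforward_ne_zero`); companion of the tree's descent of `T`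
  (`tateConjectureFor_iff_of_pushforward_ne_zero`), of `SS` (`tateSemisimplicityFor_of_pushforward_ne_zero`)
  and of the Frobenius form of `S` (`DominatedVarietiesFrobeniusSplitting`).

What this file does NOT do: no converse (`S` for `U` says nothing about the complement `Ker T`);
HC is not touched.

## Provenance

Lane `lit-hodgefound` (summit `HodgeConjecture`, Track 2 foundations library, Layer B: motives),
seat `lit-hodgefound-p29` (literature-prover, generation 38, row g38-#16).
-/

universe u v

open CategoryTheory AlgebraicGeometry
open Representation (Coinvariants)

noncomputable section

/-! ## §1 Equivariant retracts up to a scalar -/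

namespace Literature.LinearAlgebra.InvariantPairing

variable {K : Type*} [Field K] {U V : Type*} [AddCommGroup U] [Module K U] [AddCommGroup V]
  [Module K V] {G : Type*} [Group G]

/-- **Equivariant maps preserve invariants.** [cite: Kahn2020, §3.5.1] [cite: Tate1994, §1] -/
theorem apply_mem_invariants_of_equivariant {ρU : Representation K G U} {ρV : Representation K G V}
    (L : U →ₗ[K] V) (hL : ∀ (g : G) (u : U), L (ρU g u) = ρV g (L u)) {u : U}
    (hu : u ∈ ρU.invariants) : L u ∈ ρV.invariants := fun g ↦ by
  rw [← hL, hu g]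

/-- **Equivariant maps preserve the augmentation submodules `⟨g x − x⟩`.**
[cite: Kahn2020, §3.5.1] [cite: Weibel1994, Prop. 6.1.10] -/
theorem apply_mem_coinvariantsKer_of_equivariant {ρU : Representation K G U}
    {ρV : Representation K G V} (L : U →ₗ[K] V)
    (hL : ∀ (g : G) (u : U), L (ρU g u) = ρV g (L u)) {u : U} (hu : u ∈ Coinvariants.ker ρU) :
    L u ∈ Coinvariants.ker ρV := by
  have hle : (Coinvariants.ker ρU).map L ≤ Coinvariants.ker ρV := by
    change (Submodule.span K _).map L ≤ _
    rw [Submodule.map_span_le]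
    rintro _ ⟨⟨g, x⟩, rfl⟩
    change L (ρU g x - x) ∈ Coinvariants.ker ρV
    rw [map_sub, hL]
    exact Coinvariants.sub_mem_ker g (L x)
  exact hle (Submodule.mem_map_of_mem hu)

/-- **An equivariant retract up to a non-zero scalar inherits `V = V^G ⊕ 𝔞V`**: if `e : U → V` and
`T : V → U` are equivariant with `T ∘ e = q · id`, `q ≠ 0`, and `V = V^G ⊕ 𝔞V`, then `U = U^G ⊕ 𝔞U`
(`e` embeds `U^G ∩ 𝔞U` into `V^G ∩ 𝔞V = 0`; `q u = T(e u) ∈ T V^G + T 𝔞V ⊆ U^G + 𝔞U`).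
[cite: Kahn2020, §6.11 Lemma 6.30 (2) and §6.14 S^i(X, l)] [cite: Tate1994, §1] -/
theorem isCompl_invariants_coinvariantsKer_of_retract {ρU : Representation K G U}
    {ρV : Representation K G V} (e : U →ₗ[K] V) (T : V →ₗ[K] U)
    (he : ∀ (g : G) (u : U), e (ρU g u) = ρV g (e u))
    (hT : ∀ (g : G) (v : V), T (ρV g v) = ρU g (T v)) {q : K} (hq : q ≠ 0)
    (hTe : ∀ u : U, T (e u) = q • u) (hV : IsCompl ρV.invariants (Coinvariants.ker ρV)) :
    IsCompl ρU.invariants (Coinvariants.ker ρU) := by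
  refine ⟨?_, ?_⟩
  · rw [disjoint_iff, eq_bot_iff]
    intro u hu
    obtain ⟨huI, huA⟩ := Submodule.mem_inf.mp hu
    have heu : e u ∈ ρV.invariants ⊓ Coinvariants.ker ρV :=
      Submodule.mem_inf.mpr ⟨apply_mem_invariants_of_equivariant e he huI,
        apply_mem_coinvariantsKer_of_equivariant e he huA⟩
    rw [hV.inf_eq_bot, Submodule.mem_bot] at heu
    have hqu : q • u = 0 := by rw [← hTe u, heu, map_zero]
    rw [Submodule.mem_bot]
    exact (smul_eq_zero.mp hqu).resolve_left hq
  · rw [codisjoint_iff, eq_top_iff]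
    intro u _
    have hv : e u ∈ ρV.invariants ⊔ Coinvariants.ker ρV := by
      rw [hV.sup_eq_top]
      exact Submodule.mem_top
    obtain ⟨i, hi, a, ha, hia⟩ := Submodule.mem_sup.mp hv
    have hu : u = q⁻¹ • (T i + T a) := by
      rw [← map_add, hia, hTe, smul_smul, inv_mul_cancel₀ hq, one_smul]
    rw [hu]
    exact Submodule.smul_mem _ _ (Submodule.add_mem_sup
      (apply_mem_invariants_of_equivariant T hT hi) (apply_mem_coinvariantsKer_of_equivariant T hT ha))

/-- The same in Kahn's bijectivity form `U^G ⥲ U_G`. [cite: Kahn2020, §6.14 S^i(X, l)]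
[cite: Weibel1994, Prop. 6.1.10] -/
theorem bijective_coinvariantsMk_comp_invariantsSubtype_of_retract [FiniteDimensional K V]
    {ρU : Representation K G U} {ρV : Representation K G V} (e : U →ₗ[K] V) (T : V →ₗ[K] U)
    (he : ∀ (g : G) (u : U), e (ρU g u) = ρV g (e u))
    (hT : ∀ (g : G) (v : V), T (ρV g v) = ρU g (T v)) {q : K} (hq : q ≠ 0)
    (hTe : ∀ u : U, T (e u) = q • u)
    (hV : Function.Bijective (Coinvariants.mk ρV ∘ₗ ρV.invariants.subtype)) :
    Function.Bijective (Coinvariants.mk ρU ∘ₗ ρU.invariants.subtype) :=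
  (bijective_coinvariantsMk_comp_invariantsSubtype_iff_isCompl ρU).mpr
    (isCompl_invariants_coinvariantsKer_of_retract e T he hT hq hTe
      ((bijective_coinvariantsMk_comp_invariantsSubtype_iff_isCompl ρV).mp hV))

end Literature.LinearAlgebra.InvariantPairing

/-! ## §2 Kahn's `S` descends along dominations -/

namespace Literature.AlgebraicGeometry.Motives

open Literature.LinearAlgebra Literature.LinearAlgebra.InvariantPairing

namespace GaloisWeilCohomology

variable {k : Type u} [Field k] {K : Type v} [Field K] [CharZero K]
  {χ : Field.absoluteGaloisGroup k →* Kˣ} (E : GaloisWeilCohomology k K χ)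
variable {N M r : ℕ} {V U : SchemeOver k}

/-- **`Hⁱ(V)(j) = H^Γ ⊕ 𝔞H ⟹ Hⁱ(U)(j) = H^Γ ⊕ 𝔞H` for `U` dominated by `V`** (`f : V ⟶ U`,
`ζ ∈ Aʳ(V)_ℚ`, `dim V = dim U + r`, `f₊ζ ≠ 0`): `Hⁱ(U)(j)` is an equivariant retract of `Hⁱ(V)(j)` up
to the scalar `q`, `f₊ζ = q·1` (`f^*` and `f₊(· ∪ ζ)`). Degrees: `i + i' = 2 dim U`,
`i + 2r + i' = 2 dim V`. [cite: Kahn2020, §6.11 Lemma 6.30 (2) and §6.14 S^i(X, l)]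
[cite: Kleiman1968AlgebraicCycles, Prop. 1.2.4] [cite: Tate1994, §1] -/
theorem isCompl_invariants_coinvariantsKer_of_pushforward_ne_zero (hV : IsSmoothProjective N V)
    (hU : IsSmoothProjective M U) (f : V ⟶ U) {ζ : E.obj V (2 * r)}
    (hζ : ζ ∈ E.ratAlgebraicClasses V r) {he : 2 * r + 2 * M = 2 * N} {hd : 0 + 2 * M = 2 * M}
    (hne : E.pushforward (N := N) hU f he hd ζ ≠ 0) {i i' : ℕ} (hi : i + i' = 2 * M)
    (he' : i + 2 * r + i' = 2 * N) (j : ℤ)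
    (h : IsCompl (E.ρTwist V i j).invariants (Coinvariants.ker (E.ρTwist V i j))) :
    IsCompl (E.ρTwist U i j).invariants (Coinvariants.ker (E.ρTwist U i j)) := by
  obtain ⟨q, hq⟩ := E.exists_pushforward_eq_ratCast_smul_one hV hU f hζ he hd
  have hq0 : (q : K) ≠ 0 := fun h0 ↦ hne (by rw [hq, h0, zero_smul])
  have hr : M + r = N := by omega
  exact isCompl_invariants_coinvariantsKer_of_retract (E.pullback f i)
    (E.pushforward (N := N) hU f he' hi ∘ₗ (E.cup rfl).flip ζ)
    (fun g u ↦ (E.ρTwist_pullback hV hU f i j g u).symm)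
    (fun g v ↦ by
      rw [LinearMap.comp_apply, LinearMap.comp_apply, LinearMap.flip_apply, LinearMap.flip_apply]
      exact (E.ρTwist_pushforward_cup hV hU f hr hζ hi he' j g v).symm)
    hq0
    (fun u ↦ by
      rw [LinearMap.comp_apply, LinearMap.flip_apply]
      exact E.pushforward_pullback_cup_eq_smul hV hU f hq hi he' u)
    h

/-- **Kahn's `S^p(V) ⟹ S^p(U)` for `U` dominated by `V`**: `H^{2p}(U)(p)^Γ → H^{2p}(U)(p)_Γ` is
bijective if `H^{2p}(V)(p)^Γ → H^{2p}(V)(p)_Γ` is (`2p ≤ 2 dim U`).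
[cite: Kahn2020, §6.14 S^i(X, l) and §6.11 Lemma 6.30 (2)] [cite: Kleiman1968AlgebraicCycles, Prop. 1.2.4]
[cite: Tate1994, §1] -/
theorem kahnS_of_pushforward_ne_zero (hV : IsSmoothProjective N V) (hU : IsSmoothProjective M U)
    (f : V ⟶ U) {ζ : E.obj V (2 * r)} (hζ : ζ ∈ E.ratAlgebraicClasses V r)
    {he : 2 * r + 2 * M = 2 * N} {hd : 0 + 2 * M = 2 * M}
    (hne : E.pushforward (N := N) hU f he hd ζ ≠ 0) {p : ℕ} (hp : p ≤ M)
    (h : Function.Bijective (Coinvariants.mk (E.ρTwist V (2 * p) p) ∘ₗ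
      (E.ρTwist V (2 * p) p).invariants.subtype)) :
    Function.Bijective (Coinvariants.mk (E.ρTwist U (2 * p) p) ∘ₗ
      (E.ρTwist U (2 * p) p).invariants.subtype) :=
  (bijective_coinvariantsMk_comp_invariantsSubtype_iff_isCompl _).mpr
    (E.isCompl_invariants_coinvariantsKer_of_pushforward_ne_zero hV hU f hζ hne
      (i := 2 * p) (i' := 2 * M - 2 * p) (by omega) (by omega) (p : ℤ)
      ((bijective_coinvariantsMk_comp_invariantsSubtype_iff_isCompl _).mp h))

/-- The untwisted Galois representations: `Hⁱ(V) = H^Γ ⊕ 𝔞H ⟹ Hⁱ(U) = H^Γ ⊕ 𝔞H` (`i ≤ 2 dim U`).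
[cite: Kahn2020, §6.14 S^i(X, l)] [cite: Tate1994, §1] -/
theorem isCompl_invariants_coinvariantsKer_ρ_of_pushforward_ne_zero (hV : IsSmoothProjective N V)
    (hU : IsSmoothProjective M U) (f : V ⟶ U) {ζ : E.obj V (2 * r)}
    (hζ : ζ ∈ E.ratAlgebraicClasses V r) {he : 2 * r + 2 * M = 2 * N} {hd : 0 + 2 * M = 2 * M}
    (hne : E.pushforward (N := N) hU f he hd ζ ≠ 0) {i : ℕ} (hi : i ≤ 2 * M)
    (h : IsCompl (E.ρ V i).invariants (Coinvariants.ker (E.ρ V i))) :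
    IsCompl (E.ρ U i).invariants (Coinvariants.ker (E.ρ U i)) := by
  have h' := E.isCompl_invariants_coinvariantsKer_of_pushforward_ne_zero hV hU f hζ hne
    (i := i) (i' := 2 * M - i) (by omega) (by omega) 0
  rw [E.ρTwist_zero, E.ρTwist_zero] at h'
  exact h' h

end GaloisWeilCohomology

end Literature.AlgebraicGeometry.Motives

end
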